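import Literature.MathematicalPhysics.QuantumFieldTheory.Balaban1983to89.B4TorusBandLift
import Literature.MathematicalPhysics.QuantumFieldTheory.Balaban1983to89.B4ThmJoinFam
import Literature.MathematicalPhysics.QuantumFieldTheory.Balaban1983to89.B4ThmAlphaUniformBox

/-!
# `Balaban1983to89.B4ThmTorusBand` — [Balaban1983RegularityDecay] THEOREM p. 573, (1.9)–(1.12), «WITHOUT ANY RESTRICTIONS
# ON THE POINTS x, x′», ON EVERY PARALLELEPIPED OF THE TORUS `T_η` (proper or wrapping): the family `torusBandFam`
# (`rect := True`) ⊇ the instances of dag-p3 g3's `torusBoxFam`, in the typed `η`-uniform form `ThmPrintedNN`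

statement-level skeleton of published theorems with citation tags; proofs where landed; nothing here is a claim about the Yang–Mills mass gap

CITATION HEADER.  T. Bałaban, *Regularity and decay of lattice Green's functions*, Commun. Math. Phys. **89** (1983)
571–597, doi:10.1007/bf01214744 [Balaban1983RegularityDecay] (cell paper B4; held text
`paper:balaban1983-cmp89-regularity-decay`, journal page = PDF page + 570; p. 573 [PDF 3] Theorem and its last sentence «For
some simple sets Ω, e.g. for rectangular parallelepipeds, the inequalities hold without any restrictions on the points
x, x′, i.e. for all x, x′ ∈ Ω.»; p. 572 [PDF 2] «Another common case is to consider operators on subsets of a torus T_η which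
we identify with a rectangular parallelepiped in ηZ^d with periodic conditions.»).  Seat `pub-ymgap-dag-p3` gen 4 (Track A,
YM-PLAN §2 node N01 = [B4]; HOME `run/shared/lean/pub/pub-ymgap/`): FOURTH and last brick of the route to the `rect`
residual (i) of N01's cross-read (XREAD-B4 §2–§4: the parallelepiped waiver typed on the full torus only; dag-p3 g3:
proper parallelepipeds; THIS FILE: every parallelepiped of `T_η`, incl. those wrapping around in some directions).
Imports `B4TorusBandLift` (brick 3: `TorusBandInst`, `ineq19_110_liftInst`; → bricks 1–2 `B4RegionDecoupling`,
`B4LatticeBoxChart`; → g3 `B4ThmTorusBox`: the constants `dHalf`, `cNear`, `cAll` and the real-number bookkeeping lemmas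
`near_bound`, `far_bound`, `far_bound₂`, `unitnear_bound`, `unitfar_bound`, the torus geometry `tbdistS_le_tsdist1_add_tcdist`,
`tsdist1_le_tsdist1_add`, `le_tholderQ`, `pathRel_map`; → r01 g9 `B4ThmTorusPairEta`: `valG_torus`, `valDG_torus`,
`lhs19_torus`, `thmPrintedNN_torusPairFam`; → r04 `thmPrintedNN_boxPairFamNC`).

THE METHOD (ours; the print treats parallelepipeds as read).  (1.9)–(1.10) for `G_k(Ω,A)`, `Ω` a parallelepiped of
`T_η`: r01 g9's lifting members with `R₀ := 0`, their lattice hypothesis being brick 3's `ineq19_110_liftInst` (the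
periodic lift of `Ω` is a union of separated lattice parallelepipeds, on each of which r04∕p17's box Theorem holds without
restriction).  (1.11)–(1.12) for `δG_k(Ω, T_η, A)`: far from `∂Ω` r01's restricted clause; within `R₀` of `∂Ω` the split
`δGf = G_k(Ω,A)f − (G_k(T_η,A)Ef)|Ω` with BOTH terms unrestricted (the second by r01's full-torus waiver) and the factor
(1.12) recovered from `dist_T(supp f, Ω^c) ≤ dist_T(x, supp f) + dist_T(x, Ω^c)` — dag-p3 g3's bookkeeping verbatim.

WHAT THIS MODULE PROVES (kernel, sorry-free).  §1 the inclusion `Ω ⊂ T_η` (`torus`, `ιT`, extension by zero: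
`extT_ιT`, `mem_tsupp_extT_iff`, `tsdist1_extT`, `supN_eq_supN_extT`, contours `tAdm_ιT`, `twt_ιT`, `transport_ιT`);
§2 the family **`torusBandFam`** (`rect := True`; `bigBlocks` = r01's torus clause ∧ `K′ ∣ Ms_ν` ∧ `K′ ∣ P_ν`) and its
dictionary to r01's ∕ r04's families (`regular_toInst`, `regular_torus`, `bigBlocks_toInst`, `bigBlocks_torus`,
`comp_boxI_hyps`); §3 **`valG_band`, `valDG_band`, `lhs19_band`** — (1.9)–(1.10) at EVERY point of an arbitrary
parallelepiped of `T_η` (constant `c_B`, resp. `4(d+1)c_B`; r01's lifting members BY NAME with `R₀ = 0`, their lattice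
hypothesis `HI` being brick 3's `ineq19_110_liftInst`), `holder_term_band`; §4 `dvalG_band`, `dvalDG_band`, `dlhs19_band`
— (1.11)–(1.12) at every point (constants `dHalf`, `cNear` ∕ `cAll`, `R_T`; g3's split), packaged as `fam_ineq19_110`,
`fam_dvalDG`, `fam_dvalG`, `fam_ineq111_112` (one declaration per member: heartbeats); §5 **`thmPrintedNN_torusBandFam :
ThmPrintedNN (torusBandFam F d ℓ a₋ a₊ m²₊ c β (Kmod …) (KmodNC …))`**, the non-vacuity witness `band_hypotheses_met`,
`torusBandFam_signs` and the join **`thmPrintedNN_torusBandJoin`** (r01's torus pairs ⊕ all parallelepipeds of the torus,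
one set of constants, via r04∕b04's `thmPrintedNN_sumElim`), and both in the print's quantifier order
(`thmPrintedNNUnif_torusBandFam`, `thmPrintedNNUnif_torusBandJoin`: one `(δ₀, R₀)` before `α`, seat file `B4ThmAlphaUniform`).
HONEST SCOPE.  Re-indexing and assembly of EXISTING kernel theorems (r01 g8∕g9, r04∕p17, p23 g19, dag-p3 g3) — no new
analytic estimate; abelian one-parameter flow (1.2), component fields, staircase∕torus contours, running coefficient with
`a ∈ [a₋,a₊]`, masses `[0,m²₊]`, `L = ℓ+1 ≥ 2`, `d ≥ 1`, fine torus period `≥ 3`, `0 ≤ α < 1`, `Ω₀ = T_η` only (the pair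
`Ω ⊂ Ω₀` with `Ω₀` a general region keeps the `R₀` restriction — not claimed); the side condition `K′ ∣ P_ν` is ours.
One `def` (the family); no `Prop` fact, no `sorry`; axioms standard.  Count-neutral for YM-PLAN (typed 28∕28; discharged
count unmoved; a re-pin of NODE 00's `famE` is node00-def's ∕ the leads' decision); nothing here concerns the continuum
limit, ℝ⁴, OS axioms, a mass gap or the Clay problem.
-/

namespace Literature.MathematicalPhysics.QuantumFieldTheory.Balaban1983to89.B4ThmTorusBand

open Literature.MathematicalPhysics.QuantumFieldTheory.Balaban1983to89
open Literature.MathematicalPhysics.QuantumFieldTheory.Balaban1983to89.B4 (EtaSetting Ineq19_110 Ineq111_112)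
open Literature.MathematicalPhysics.QuantumFieldTheory.Balaban1983to89.B4Ineq111ZeroNestEta (ThmPrintedNN)
open Literature.MathematicalPhysics.QuantumFieldTheory.Balaban1983to89.B4Reflection242 (boxDom mem_boxDom nbrs mem_nbrs
  blk)
open Literature.MathematicalPhysics.QuantumFieldTheory.Balaban1983to89.B4GaugeCovariance
open Literature.MathematicalPhysics.QuantumFieldTheory.Balaban1983to89.B4ContourShift (supNorm supNorm_nonneg)
open Literature.MathematicalPhysics.QuantumFieldTheory.Balaban1983to89.B4Lower18 (fineDom mem_fineDom IsBlockUnion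
  fineDom_isBlockUnion fineDom_boxDom)
open Literature.MathematicalPhysics.QuantumFieldTheory.Balaban1983to89.B4Lower18Regular (e1 PathRel)
open Literature.MathematicalPhysics.QuantumFieldTheory.Balaban1983to89.B4Lemma21Region (siteNorm)
open Literature.MathematicalPhysics.QuantumFieldTheory.Balaban1983to89.B4Lemma22Reduce231 (supN le_supN supN_nonneg
  supN_le siteNorm_nonneg siteNorm_zero)
open Literature.MathematicalPhysics.QuantumFieldTheory.Balaban1983to89.B4Lemma22HolderBox (IsNNChain siteNorm_sub_le)
open Literature.MathematicalPhysics.QuantumFieldTheory.Balaban1983to89.B4RegionCubeCarrier (incl fineDom_mono)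
open Literature.MathematicalPhysics.QuantumFieldTheory.Balaban1983to89.B2Lemma24KerOmega (boxLabels mem_boxLabels hnk)
open Literature.MathematicalPhysics.QuantumFieldTheory.Balaban1983to89.B2Prop22RegularTorusPair (tor_mem_tsupp le_tsdist1)
open Literature.MathematicalPhysics.QuantumFieldTheory.Balaban1983to89.B4ThmRegionPairEta (RegionPairInst regionPairFam
  Kmod region_pair_members)
open Literature.MathematicalPhysics.QuantumFieldTheory.Balaban1983to89.B4ThmBoxPairEta (BoxPairInst boxPairFam)
open Literature.MathematicalPhysics.QuantumFieldTheory.Balaban1983to89.B4ThmBoxPairEtaNoCollar (boxPairFamNC KmodNC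
  thmPrintedNN_boxPairFamNC)
open Literature.MathematicalPhysics.QuantumFieldTheory.Balaban1983to89.B4ThmTorusPairEta (thmPrintedNN_torusPairFam
  valG_torus valDG_torus lhs19_torus siteNorm_transport_sub_le decay_mono)
open Literature.MathematicalPhysics.QuantumFieldTheory.Balaban1983to89.B4TorusRegionOp
open Literature.MathematicalPhysics.QuantumFieldTheory.Balaban1983to89.B4TorusRegionLift
open Literature.MathematicalPhysics.QuantumFieldTheory.Balaban1983to89.B4TorusPairFam
open Literature.MathematicalPhysics.QuantumFieldTheory.Balaban1983to89.B4ThmTorusBox (tnorm_sub_rev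
  tbdistS_le_tsdist1_add_tcdist tsdist1_le_tsdist1_add le_tholderQ pathRel_map)
open Literature.MathematicalPhysics.QuantumFieldTheory.Balaban1983to89.B4ThmTorusBox.TorusBoxInst (dHalf cNear cAll
  dHalf_pos dHalf_le cAll_bounds cNear_bounds rhs_le rhs_le₂ near_bound far_bound far_bound₂ unitnear_bound unitfar_bound)
open Literature.MathematicalPhysics.QuantumFieldTheory.Balaban1983to89.B4TorusBandLift (TorusBandInst)
open Literature.MathematicalPhysics.QuantumFieldTheory.Balaban1983to89.B4ThmJoinFam (thmPrintedNN_sumElim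
  torusPairFam_signs)
open Literature.MathematicalPhysics.QuantumFieldTheory.Balaban1983to89.B4ThmAlphaUniform (ThmPrintedNNUnif
  thmPrintedNNUnif_torusPairFam thmPrintedNNUnif_sumElim)
open Literature.MathematicalPhysics.QuantumFieldTheory.Balaban1983to89.B4ThmAlphaUniformBox
  (thmPrintedNNUnif_boxPairFamNC)
open scoped Matrix

noncomputable section

variable {d : ℕ} {ι : Type} [Fintype ι] [DecidableEq ι]

open B4TorusBandLift.TorusBandInst

variable {ℓ : ℕ} {amin aplus m2plus : ℝ} (j : TorusBandInst d ℓ amin aplus m2plus)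

/-! ## §1. The inclusion `Ω ⊂ T_η`: extension by zero, distances, sup norms, contours, transporters -/

section Inclusion

/-- THE FULL-TORUS PAIR `T_η ⊂ T_η` of r01's family (where `rect` holds). [cite: Balaban1983RegularityDecay, p.572 «a torus T_η which we identify with a rectangular parallelepiped»] -/
abbrev torus : TorusPairInst d ℓ amin aplus m2plus where
  k := j.k
  hk := j.hk
  P := j.P
  hP := j.hP
  h3 := j.h3
  Ω₀T := boxDom j.P
  ΩT := boxDom j.P
  hbox := Finset.Subset.refl _
  hsub := Finset.Subset.refl _
  a := j.a
  m2 := j.m2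
  ha1 := j.ha1
  ha2 := j.ha2
  hm1 := j.hm1
  hm2 := j.hm2
  Ac := j.Ac
  e := j.e

/-- the inclusion of the parallelepiped's sites into the torus' sites. [cite: Balaban1983RegularityDecay, (1.11) p.573, dictionary] -/
abbrev ιT (x : ↥(fineDom ((ℓ + 1) ^ j.k) (boxLabels j.Ms j.o))) : ↥(fineDom ((ℓ + 1) ^ j.k) (boxDom j.P)) :=
  incl (hnk ℓ j.k) j.hΩP x

omit [Fintype ι] [DecidableEq ι] in
/-- the inclusion does not move the point. [cite: Balaban1983RegularityDecay, (1.11) p.573, dictionary] -/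
theorem ιT_val (x : ↥(fineDom ((ℓ + 1) ^ j.k) (boxLabels j.Ms j.o))) : (ιT j x).1 = x.1 := by
  simp only [ιT, incl]

omit [Fintype ι] [DecidableEq ι] in
/-- the extension by zero at a site of `Ω`. [cite: Balaban1983RegularityDecay, (1.11) p.573, dictionary] -/
theorem extT_ιT (f : ↥(fineDom ((ℓ + 1) ^ j.k) (boxLabels j.Ms j.o)) × ι → ℝ)
    (x : ↥(fineDom ((ℓ + 1) ^ j.k) (boxLabels j.Ms j.o))) (c : ι) : j.toInst.extT f (ιT j x, c) = f (x, c) := by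
  have hx : blk ((ℓ + 1) ^ j.k) (ιT j x).1 ∈ boxLabels j.Ms j.o := by
    rw [ιT_val]; exact (mem_fineDom (hnk ℓ j.k)).1 x.2
  refine (j.toInst.extT_of_mem f (ιT j x, c) hx).trans ?_
  exact congrArg (fun y : ↥(fineDom ((ℓ + 1) ^ j.k) (boxLabels j.Ms j.o)) => f (y, c)) (Subtype.ext (ιT_val j x))

omit [Fintype ι] [DecidableEq ι] in
/-- a torus point whose block label lies in the label box is the inclusion of a point of `Ω`.
[cite: Balaban1983RegularityDecay, (1.1) p.572, dictionary] -/
theorem exists_ιT_of_blk_mem (w : ↥(fineDom ((ℓ + 1) ^ j.k) (boxDom j.P)))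
    (hw : blk ((ℓ + 1) ^ j.k) w.1 ∈ boxLabels j.Ms j.o) : ∃ x, ιT j x = w :=
  ⟨⟨w.1, (mem_fineDom (hnk ℓ j.k)).2 hw⟩, Subtype.ext (ιT_val j _)⟩

omit [DecidableEq ι] in
/-- the support of the extension is the image of the support. [cite: Balaban1983RegularityDecay, (1.11) p.573, dictionary] -/
theorem mem_tsupp_extT_iff (f : ↥(fineDom ((ℓ + 1) ^ j.k) (boxLabels j.Ms j.o)) × ι → ℝ)
    (w : ↥(fineDom ((ℓ + 1) ^ j.k) (boxDom j.P))) :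
    w ∈ tsupp (j.toInst.extT f) ↔ ∃ x ∈ tsupp f, ιT j x = w := by
  rw [tor_mem_tsupp]
  constructor
  · rintro ⟨c, hc⟩
    by_cases hw : blk ((ℓ + 1) ^ j.k) w.1 ∈ boxLabels j.Ms j.o
    · obtain ⟨x, rfl⟩ := exists_ιT_of_blk_mem j w hw
      refine ⟨x, ?_, rfl⟩
      rw [tor_mem_tsupp]
      exact ⟨c, by rwa [extT_ιT j] at hc⟩
    · exact absurd (j.toInst.extT_of_not_mem f (w, c) hw) hc
  · rintro ⟨x, hx, rfl⟩
    obtain ⟨c, hc⟩ := (tor_mem_tsupp).1 hx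
    exact ⟨c, by rwa [extT_ιT j]⟩

omit [DecidableEq ι] in
/-- **`dist_T(x, supp Ef) = dist_T(x, supp f)`** for the extension by zero from `Ω` to `T_η`.
[cite: Balaban1983RegularityDecay, (1.10)–(1.11) p.573, dictionary] -/
theorem tsdist1_extT (f : ↥(fineDom ((ℓ + 1) ^ j.k) (boxLabels j.Ms j.o)) × ι → ℝ)
    (x : ↥(fineDom ((ℓ + 1) ^ j.k) (boxLabels j.Ms j.o))) :
    tsdist1 j.P (ιT j x) (j.toInst.extT f) = tsdist1 j.P x f := by
  by_cases hne : (tsupp f).Nonempty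
  · have hne' : (tsupp (j.toInst.extT f)).Nonempty := by
      obtain ⟨z, hz⟩ := hne
      exact ⟨ιT j z, (mem_tsupp_extT_iff j f _).2 ⟨z, hz, rfl⟩⟩
    refine le_antisymm ?_ ?_
    · refine le_tsdist1 j.P x f hne fun z hz => ?_
      have hmem : ιT j z ∈ tsupp (j.toInst.extT f) := (mem_tsupp_extT_iff j f (ιT j z)).2 ⟨z, hz, rfl⟩
      have h := tsdist1_le j.P (ιT j x) (j.toInst.extT f) hmem
      rw [ιT_val, ιT_val] at h
      exact h
    · refine le_tsdist1 j.P (ιT j x) (j.toInst.extT f) hne' fun w hw => ?_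
      obtain ⟨z, hz, rfl⟩ := (mem_tsupp_extT_iff j f w).1 hw
      rw [ιT_val, ιT_val]
      exact tsdist1_le j.P x f hz
  · have hne' : ¬ (tsupp (j.toInst.extT f)).Nonempty := by
      rintro ⟨w, hw⟩
      obtain ⟨z, hz, -⟩ := (mem_tsupp_extT_iff j f w).1 hw
      exact hne ⟨z, hz⟩
    unfold tsdist1
    rw [dif_neg hne, dif_neg hne']

omit [Fintype ι] [DecidableEq ι] in
/-- the extension at a site of `Ω`, as a colour vector. [cite: Balaban1983RegularityDecay, (1.11) p.573, dictionary] -/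
theorem fld_extT_ιT (f : ↥(fineDom ((ℓ + 1) ^ j.k) (boxLabels j.Ms j.o)) × ι → ℝ)
    (x : ↥(fineDom ((ℓ + 1) ^ j.k) (boxLabels j.Ms j.o))) : fld (j.toInst.extT f) (ιT j x) = fld f x := by
  funext c; exact extT_ιT j f x c

omit [DecidableEq ι] in
/-- **`‖f‖_∞ = ‖Ef‖_∞`** for the extension by zero. [cite: Balaban1983RegularityDecay, (1.11) p.573, dictionary] -/
theorem supN_eq_supN_extT (f : ↥(fineDom ((ℓ + 1) ^ j.k) (boxLabels j.Ms j.o)) × ι → ℝ) :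
    supN f = supN (j.toInst.extT f) := by
  refine le_antisymm (supN_le (supN_nonneg _) fun x => ?_) (supN_le (supN_nonneg f) fun w => ?_)
  · rw [← fld_extT_ιT]; exact le_supN _ _
  · by_cases hw : blk ((ℓ + 1) ^ j.k) w.1 ∈ boxLabels j.Ms j.o
    · obtain ⟨x, rfl⟩ := exists_ιT_of_blk_mem j w hw
      rw [fld_extT_ιT]; exact le_supN f _
    · have : fld (j.toInst.extT f) w = 0 := by
        funext c; exact j.toInst.extT_of_not_mem f (w, c) hw
      rw [this, siteNorm_zero]; exact supN_nonneg f

omit [Fintype ι] [DecidableEq ι] in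
/-- **AN ADMISSIBLE TORUS CONTOUR OF `Ω` IS AN ADMISSIBLE TORUS CONTOUR OF `T_η`** (same points).
[cite: Balaban1983RegularityDecay, p.573 «Γ_{x,x′} … contour», (1.11) p.573] -/
theorem tAdm_ιT {μ : Fin (d + 1)} {x x' : ↥(fineDom ((ℓ + 1) ^ j.k) (boxLabels j.Ms j.o))}
    {l : List ↥(fineDom ((ℓ + 1) ^ j.k) (boxLabels j.Ms j.o))} (hl : TAdm j.P μ x x' l) :
    TAdm j.P μ (ιT j x) (ιT j x') (l.map (ιT j)) := by
  obtain ⟨hbx, hbx', hne, hpath, hend, hlen, hball⟩ := hl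
  refine ⟨?_, ?_, ?_, ?_, ?_, ?_, ?_⟩
  · rw [ιT_val]; exact fineDom_mono (hnk ℓ j.k) j.hΩP hbx
  · rw [ιT_val]; exact fineDom_mono (hnk ℓ j.k) j.hΩP hbx'
  · rw [ιT_val, ιT_val]; exact hne
  · refine pathRel_map (r := fun u v : ↥(fineDom ((ℓ + 1) ^ j.k) (boxLabels j.Ms j.o)) =>
      TNbr ((ℓ + 1) ^ j.k) j.P u.1 v.1) (ιT j) (fun u v huv => ?_) x l hpath
    show TNbr _ _ (ιT j u).1 (ιT j v).1
    rw [ιT_val, ιT_val]; exact huv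
  · rw [B4TorusBoxReindex.pathEnd_map, hend]
  · rw [List.length_map, ιT_val, ιT_val]; exact hlen
  · intro z' hz'
    obtain ⟨z, hz, rfl⟩ := List.mem_map.1 hz'
    rw [ιT_val, ιT_val, ιT_val]; exact hball z hz

omit [Fintype ι] [DecidableEq ι] in
/-- the weight does not see the inclusion. [cite: Balaban1983RegularityDecay, (1.9) p.573, dictionary] -/
theorem twt_ιT (α : ℝ) (x x' : ↥(fineDom ((ℓ + 1) ^ j.k) (boxLabels j.Ms j.o))) :
    twt j.P α (ιT j x) (ιT j x') = twt j.P α x x' := by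
  unfold twt; rw [ιT_val, ιT_val]

/-- the transporter of a contour of `Ω` computed with the torus links of `T_η` along the inclusion is the transporter
computed in `Ω` (same bonds, same field). [cite: Balaban1983RegularityDecay, (1.4) p.572 «U(A(Γ))», dictionary] -/
theorem transport_ιT (F : OrthFlow ι) (κ : ℝ) (x : ↥(fineDom ((ℓ + 1) ^ j.k) (boxLabels j.Ms j.o)))
    (l : List ↥(fineDom ((ℓ + 1) ^ j.k) (boxLabels j.Ms j.o))) :
    transport (fieldLink F κ fun a b : ↥(fineDom ((ℓ + 1) ^ j.k) (boxDom j.P)) =>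
        torBond ((ℓ + 1) ^ j.k) j.P j.Ac a.1 b.1) (ιT j x) (l.map (ιT j))
      = transport (fieldLink F κ fun a b : ↥(fineDom ((ℓ + 1) ^ j.k) (boxLabels j.Ms j.o)) =>
          torBond ((ℓ + 1) ^ j.k) j.P j.Ac a.1 b.1) x l := by
  have hW : (fun a b : ↥(fineDom ((ℓ + 1) ^ j.k) (boxLabels j.Ms j.o)) =>
      fieldLink F κ (fun u v : ↥(fineDom ((ℓ + 1) ^ j.k) (boxDom j.P)) => torBond ((ℓ + 1) ^ j.k) j.P j.Ac u.1 v.1)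
        (ιT j a) (ιT j b))
      = fieldLink F κ (fun a b : ↥(fineDom ((ℓ + 1) ^ j.k) (boxLabels j.Ms j.o)) =>
          torBond ((ℓ + 1) ^ j.k) j.P j.Ac a.1 b.1) := by
    funext a b
    show F.U (κ * torBond _ j.P j.Ac (ιT j a).1 (ιT j b).1) = F.U (κ * torBond _ j.P j.Ac a.1 b.1)
    rw [ιT_val, ιT_val]
  rw [B4TorusBoxReindex.transport_map, hW]

end Inclusion

/-! ## §2. The family of settings on all parallelepipeds of the torus -/

/-- **THE FAMILY OF SETTINGS OF THE THEOREM ON ALL PARALLELEPIPEDS OF THE TORUS** (`Ω ⊂ Ω₀ = T_η`, `Ω` = the unit blocks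
with labels in any box `o + Π[0,Ms) ⊆ Π[0,P)`, wrapping directions allowed): b04's `EtaSetting` filled with the SAME
printed objects as r01's `torusPairFam` at the torus pair `toInst` (dag-p3 g3's `torusBoxFam`, field by field), with
`rect := True` and the big-block condition of both lineages plus `K′ ∣ P_ν`. [cite: Balaban1983RegularityDecay, (1.7) p.572, Theorem (1.9)–(1.12) p.573 with its last sentence; p.572 «operators on subsets of a torus T_η»] -/
def torusBandFam (F : OrthFlow ι) (d ℓ : ℕ) (amin aplus m2plus creg β : ℝ) (K K' : ℕ)
    (j : TorusBandInst d ℓ amin aplus m2plus) : EtaSetting where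
  Site := ↥(fineDom ((ℓ + 1) ^ j.k) (boxLabels j.Ms j.o))
  Dir := Fin (d + 1)
  Src := ↥(fineDom ((ℓ + 1) ^ j.k) (boxLabels j.Ms j.o)) × ι → ℝ
  e := j.e
  regular := ∀ x ∈ fineDom ((ℓ + 1) ^ j.k) (boxDom j.P), ∀ μ ν : Fin (d + 1),
    |j.Ac (twrap ((ℓ + 1) ^ j.k) j.P (x + e1 μ)) ν - j.Ac x ν| ≤ creg * j.e ^ (β - 1) / ((ℓ + 1) ^ j.k : ℕ)
  bigBlocks := (IsBlockUnion K (boxDom j.P) ∧ IsBlockUnion K (boxLabels j.Ms j.o) ∧ ∀ ν, K ∣ j.P ν) ∧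
    (∀ ν, K' ∣ j.Ms ν) ∧ ∀ ν, K' ∣ j.P ν
  rect := True
  pdist := fun x y => tnorm ((ℓ + 1) ^ j.k) j.P (x.1 - y.1) / (((ℓ + 1) ^ j.k : ℕ) : ℝ)
  sdist1 := fun x f => tsdist1 j.P x f
  sdist2 := fun x x' f => min (tsdist1 j.P x f) (tsdist1 j.P x' f)
  bdist1 := fun x => tcdist j.P x
  bdist2 := fun x x' => min (tcdist j.P x) (tcdist j.P x')
  bdistS := fun f => tbdistS j.P f
  supNorm := fun f => supN f
  l2Norm := fun f => Real.sqrt (∑ p, f p ^ 2)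
  ssdist := fun f f' => tssdist j.P f f'
  lhs19 := fun α μ f x x' => tholderQ j.P F j.toInst.κ j.Ac α μ (j.toInst.DT F μ *ᵥ (j.toInst.GT F *ᵥ f)) x x'
  valDG := fun μ f x => siteNorm (fld (j.toInst.DT F μ *ᵥ (j.toInst.GT F *ᵥ f)) x)
  valG := fun f x => siteNorm (fld (j.toInst.GT F *ᵥ f) x)
  dlhs19 := fun α μ f x x' => tholderQ j.P F j.toInst.κ j.Ac α μ (j.toInst.DT F μ *ᵥ j.toInst.deltaT F f) x x'
  dvalDG := fun μ f x => siteNorm (fld (j.toInst.DT F μ *ᵥ j.toInst.deltaT F f) x)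
  dvalG := fun f x => siteNorm (fld (j.toInst.deltaT F f) x)
  lower18 := fun γ => ∀ v : ↥(fineDom ((ℓ + 1) ^ j.k) (boxLabels j.Ms j.o)) × ι → ℝ,
    γ * (v ⬝ᵥ v) ≤ v ⬝ᵥ (j.toInst.HT F *ᵥ v)
  pair := fun m μ ν f' f => |f' ⬝ᵥ j.toInst.opXT F m μ ν f|
  dpair := fun m μ ν f' f => |f' ⬝ᵥ (j.toInst.opXT F m μ ν f - j.toInst.resT (j.toInst.opX₀T F m μ ν (j.toInst.extT f)))|

section Dictionary

variable (F : OrthFlow ι) {creg β : ℝ} {K K' : ℕ}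

/-- the regularity clause of the family is r01's at `toInst` (definitionally). [cite: Balaban1983RegularityDecay, (1.7) p.572] -/
theorem regular_toInst (h : (torusBandFam F d ℓ amin aplus m2plus creg β K K' j).regular) :
    (torusPairFam F d ℓ amin aplus m2plus creg β K j.toInst).regular := h

/-- (1.7) on `Ω₀ = T_η` is the same clause for the full-torus pair. [cite: Balaban1983RegularityDecay, (1.7) p.572] -/
theorem regular_torus (h : (torusBandFam F d ℓ amin aplus m2plus creg β K K' j).regular) :
    (torusPairFam F d ℓ amin aplus m2plus creg β K (torus j)).regular := h

/-- the big-block clause restricted to r01's family at `toInst`. [cite: Balaban1983RegularityDecay, p.572 «unions of big blocks»] -/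
theorem bigBlocks_toInst (h : (torusBandFam F d ℓ amin aplus m2plus creg β K K' j).bigBlocks) :
    (torusPairFam F d ℓ amin aplus m2plus creg β K j.toInst).bigBlocks := h.1

/-- the big-block clause for the full-torus pair. [cite: Balaban1983RegularityDecay, p.572 «unions of big blocks»] -/
theorem bigBlocks_torus (h : (torusBandFam F d ℓ amin aplus m2plus creg β K K' j).bigBlocks) :
    (torusPairFam F d ℓ amin aplus m2plus creg β K (torus j)).bigBlocks := by
  obtain ⟨⟨h0, -, hP⟩, -, -⟩ := h
  exact ⟨h0, h0, hP⟩

/-- **THE BOX THEOREM's HYPOTHESES AT EVERY COMPONENT OF EVERY LIFT**: (1.7) for the translated periodic field and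
`K′`-divisibility of the components' sides (bricks 3's `regular_comp_boxI`, `bigBlocks_comp_boxI`). [cite: Balaban1983RegularityDecay, (1.7) p.572, p.572 «unions of big blocks»] -/
theorem comp_boxI_hyps (h : (torusBandFam F d ℓ amin aplus m2plus creg β K K' j).regular)
    (hb : (torusBandFam F d ℓ amin aplus m2plus creg β K K' j).bigBlocks) (R : ℕ) (s : Fin (d + 1) → ℤ) :
    (boxPairFamNC F d ℓ amin aplus m2plus creg β K' (j.comp R s).boxI).regular ∧
      (boxPairFamNC F d ℓ amin aplus m2plus creg β K' (j.comp R s).boxI).bigBlocks :=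
  ⟨j.regular_comp_boxI F R (s := s) (K := K) h, j.bigBlocks_comp_boxI F R (s := s) hb.2.1 hb.2.2⟩

end Dictionary

/-! ## §3. (1.9)–(1.10) at every point of an arbitrary parallelepiped of the torus (r01's lifting members, `R₀ = 0`) -/

section Members

variable (F : OrthFlow ι) {creg β : ℝ} {K K' : ℕ} {α δT cT RT δB cB RB : ℝ} (ha : 0 < amin) (hℓ : 1 ≤ ℓ)
  (hα0 : 0 ≤ α) (hα1 : α ≤ 1) (hδT : 0 < δT) (hcT : 0 < cT) (hδB : 0 < δB) (hcB : 0 < cB) (hRT : 0 < RT)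
  (HB : ∀ (R : ℕ) (s : Fin (d + 1) → ℤ), (∀ ν, |s ν| ≤ R) →
    Ineq19_110 (boxPairFamNC F d ℓ amin aplus m2plus creg β K' (j.comp R s).boxI) α δB cB RB)

include ha hℓ hδB hcB HB in
/-- the lattice hypothesis of r01's lifting members, at `R₀ = 0`, from brick 3. [cite: Balaban1983RegularityDecay, Theorem (1.9)–(1.10) p.573 (bookkeeping)] -/
theorem HI (K R : ℕ) :
    Ineq19_110 (regionPairFam F d ℓ amin aplus m2plus creg β K (j.toInst.liftInst R)) α δB cB 0 :=
  j.ineq19_110_liftInst F R ha hℓ hδB hcB (HB R) 0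

include ha hℓ hδB hcB HB in
/-- **(1.10), VALUE, AT EVERY SITE OF AN ARBITRARY PARALLELEPIPED OF THE TORUS**:
`|(G_k(Ω,A)f)(x)| ≤ c_B e^{−δ_B dist_T(x, supp f)}‖f‖_∞`. [cite: Balaban1983RegularityDecay, (1.10) p.573 «for rectangular parallelepipeds … without any restrictions»] -/
theorem valG_band (f : ↥(fineDom ((ℓ + 1) ^ j.k) (boxLabels j.Ms j.o)) × ι → ℝ)
    (x : ↥(fineDom ((ℓ + 1) ^ j.k) (boxLabels j.Ms j.o))) :
    (torusBandFam F d ℓ amin aplus m2plus creg β K K' j).valG f x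
      ≤ cB * Real.exp (-(δB * tsdist1 j.P x f)) * supN f :=
  valG_torus j.toInst F ha hℓ hδB hcB (K := K') (HI j F ha hℓ hδB hcB HB K') f x (Or.inr (tcdist_nonneg j.P x))

include ha hℓ hδB hcB HB in
/-- **(1.10), DERIVATIVE, AT EVERY SITE.** [cite: Balaban1983RegularityDecay, (1.10) p.573 «for rectangular parallelepipeds … without any restrictions»] -/
theorem valDG_band (μ : Fin (d + 1)) (f : ↥(fineDom ((ℓ + 1) ^ j.k) (boxLabels j.Ms j.o)) × ι → ℝ)
    (x : ↥(fineDom ((ℓ + 1) ^ j.k) (boxLabels j.Ms j.o))) :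
    (torusBandFam F d ℓ amin aplus m2plus creg β K K' j).valDG μ f x
      ≤ cB * Real.exp (-(δB * tsdist1 j.P x f)) * supN f :=
  valDG_torus j.toInst F ha hℓ hδB hcB (K := K') (HI j F ha hℓ hδB hcB HB K') μ f x (Or.inr (tcdist_nonneg j.P x))

include ha hℓ hα0 hα1 hδB hcB HB in
/-- **(1.9) AT EVERY PAIR OF SITES** (constant `4(d+1)c_B`: r01's close∕far treatment of torus contours).
[cite: Balaban1983RegularityDecay, (1.9) p.573 «for rectangular parallelepipeds … without any restrictions»] -/
theorem lhs19_band (μ : Fin (d + 1)) (f : ↥(fineDom ((ℓ + 1) ^ j.k) (boxLabels j.Ms j.o)) × ι → ℝ)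
    (x x' : ↥(fineDom ((ℓ + 1) ^ j.k) (boxLabels j.Ms j.o))) :
    (torusBandFam F d ℓ amin aplus m2plus creg β K K' j).lhs19 α μ f x x'
      ≤ 4 * ((d : ℝ) + 1) * cB * Real.exp (-(δB * min (tsdist1 j.P x f) (tsdist1 j.P x' f))) * supN f :=
  lhs19_torus j.toInst F ha hℓ hδB hcB hα0 hα1 (K := K') (HI j F ha hℓ hδB hcB HB K') μ f x x'
    (Or.inr (le_min (tcdist_nonneg j.P x) (tcdist_nonneg j.P x')))

include ha hℓ hα0 hα1 hδB hcB HB in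
/-- the Hölder term of every admissible torus contour of `Ω` (dominated by `tholderQ`, hence by (1.9)).
[cite: Balaban1983RegularityDecay, (1.9) p.573 «Γ_{x,x′} denotes a shortest contour»] -/
theorem holder_term_band {μ : Fin (d + 1)} (f : ↥(fineDom ((ℓ + 1) ^ j.k) (boxLabels j.Ms j.o)) × ι → ℝ)
    {x x' : ↥(fineDom ((ℓ + 1) ^ j.k) (boxLabels j.Ms j.o))} {l : List ↥(fineDom ((ℓ + 1) ^ j.k) (boxLabels j.Ms j.o))}
    (hl : TAdm j.P μ x x' l) :
    twt j.P α x x' * siteNorm (transport (fieldLink F j.toInst.κ fun a b : ↥(fineDom ((ℓ + 1) ^ j.k) (boxLabels j.Ms j.o)) =>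
        torBond ((ℓ + 1) ^ j.k) j.P j.Ac a.1 b.1) x l *ᵥ fld (j.toInst.DT F μ *ᵥ (j.toInst.GT F *ᵥ f)) x'
        - fld (j.toInst.DT F μ *ᵥ (j.toInst.GT F *ᵥ f)) x)
      ≤ 4 * ((d : ℝ) + 1) * (cB * Real.exp (-(δB * min (tsdist1 j.P x f) (tsdist1 j.P x' f))) * supN f) := by
  have h := (le_tholderQ j.P F j.toInst.κ j.Ac (j.toInst.DT F μ *ᵥ (j.toInst.GT F *ᵥ f)) hl).trans
    (lhs19_band j F (K := K') ha hℓ hα0 hα1 hδB hcB HB μ f x x')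
  linarith [h]


/-! ## §4. (1.11)–(1.12) at every point: dag-p3 g3's split, with the unrestricted band members of §3 -/

/-- full torus (1.10), value, at every site (r01: `rect` holds on `T_η`). [cite: Balaban1983RegularityDecay, (1.10) p.573, p.572 «a torus T_η»] -/
theorem torus_valG (HF : Ineq19_110 (torusPairFam F d ℓ amin aplus m2plus creg β K (torus j)) α δT cT RT)
    (g : ↥(fineDom ((ℓ + 1) ^ j.k) (boxDom j.P)) × ι → ℝ) (w : ↥(fineDom ((ℓ + 1) ^ j.k) (boxDom j.P))) :
    siteNorm (fld ((torus j).GT F *ᵥ g) w) ≤ cT * Real.exp (-(δT * tsdist1 j.P w g)) * supN g :=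
  (HF.2 (0 : Fin (d + 1)) g w (Or.inl (fineDom_boxDom (hnk ℓ j.k) j.P))).2

/-- full torus (1.10), derivative, at every site. [cite: Balaban1983RegularityDecay, (1.10) p.573, p.572 «a torus T_η»] -/
theorem torus_valDG (HF : Ineq19_110 (torusPairFam F d ℓ amin aplus m2plus creg β K (torus j)) α δT cT RT)
    (μ : Fin (d + 1)) (g : ↥(fineDom ((ℓ + 1) ^ j.k) (boxDom j.P)) × ι → ℝ)
    (w : ↥(fineDom ((ℓ + 1) ^ j.k) (boxDom j.P))) :
    siteNorm (fld ((torus j).DT F μ *ᵥ ((torus j).GT F *ᵥ g)) w) ≤ cT * Real.exp (-(δT * tsdist1 j.P w g)) * supN g :=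
  (HF.2 μ g w (Or.inl (fineDom_boxDom (hnk ℓ j.k) j.P))).1

/-- full torus (1.9) at every pair. [cite: Balaban1983RegularityDecay, (1.9) p.573, p.572 «a torus T_η»] -/
theorem torus_lhs19 (HF : Ineq19_110 (torusPairFam F d ℓ amin aplus m2plus creg β K (torus j)) α δT cT RT)
    (μ : Fin (d + 1)) (g : ↥(fineDom ((ℓ + 1) ^ j.k) (boxDom j.P)) × ι → ℝ)
    (w w' : ↥(fineDom ((ℓ + 1) ^ j.k) (boxDom j.P))) :
    tholderQ j.P F (torus j).κ j.Ac α μ ((torus j).DT F μ *ᵥ ((torus j).GT F *ᵥ g)) w w'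
      ≤ cT * Real.exp (-(δT * min (tsdist1 j.P w g) (tsdist1 j.P w' g))) * supN g :=
  HF.1 μ g w w' (Or.inl (fineDom_boxDom (hnk ℓ j.k) j.P))

include ha hℓ hδT hcT hδB hcB hRT HB in
/-- **(1.11)–(1.12), VALUE, AT EVERY SITE OF AN ARBITRARY PARALLELEPIPED OF THE TORUS**: far from `∂Ω` r01's clause;
within `R₀` of `∂Ω` the split `δGf = G_k(Ω,A)f − (G_k(T_η,A)Ef)|Ω` (both unrestricted) with the factor (1.12) from
`dist_T(supp f, Ω^c) ≤ dist_T(x, supp f) + dist_T(x, Ω^c)`. [cite: Balaban1983RegularityDecay, (1.11)–(1.12) p.573 «for rectangular parallelepipeds … without any restrictions»] -/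
theorem dvalG_band (HT : Ineq111_112 (torusPairFam F d ℓ amin aplus m2plus creg β K j.toInst) α δT cT RT)
    (HF : Ineq19_110 (torusPairFam F d ℓ amin aplus m2plus creg β K (torus j)) α δT cT RT)
    (f : ↥(fineDom ((ℓ + 1) ^ j.k) (boxLabels j.Ms j.o)) × ι → ℝ) (x : ↥(fineDom ((ℓ + 1) ^ j.k) (boxLabels j.Ms j.o))) :
    (torusBandFam F d ℓ amin aplus m2plus creg β K K' j).dvalG f x ≤ cNear cT cB δT δB RT *
      Real.exp (-(dHalf δT δB * tsdist1 j.P x f)) *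
      Real.exp (-(dHalf δT δB * tcdist j.P x + dHalf δT δB * tbdistS j.P f)) * supN f := by
  show siteNorm (fld (j.toInst.deltaT F f) x) ≤ _
  by_cases hfar : RT ≤ tcdist j.P x
  · have h : siteNorm (fld (j.toInst.deltaT F f) x) ≤ cT * Real.exp (-(δT * tsdist1 j.P x f))
        * Real.exp (-(δT * tcdist j.P x + δT * tbdistS j.P f)) * supN f := (HT.2 (0 : Fin (d + 1)) f x (Or.inr hfar)).2
    exact far_bound hδT hcT hδB hcB hRT h (tsdist1_nonneg j.P x f) (tcdist_nonneg j.P x) (tbdistS_nonneg j.P f)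
      (supN_nonneg f)
  · have hfar' : tcdist j.P x ≤ RT := (not_le.1 hfar).le
    refine near_bound hδT hcT hδB hcB ?_ (tsdist1_nonneg j.P x f) (supN_nonneg f)
      (tbdistS_le_tsdist1_add_tcdist (hnk ℓ j.k) j.P j.hP f x) hfar'
    have h1 : siteNorm (fld (j.toInst.GT F *ᵥ f) x) ≤ cB * Real.exp (-(δB * tsdist1 j.P x f)) * supN f :=
      valG_band j F ha hℓ hδB hcB (K := K) HB f x
    have h2 := torus_valG j F HF (j.toInst.extT f) (ιT j x)
    rw [tsdist1_extT j, ← supN_eq_supN_extT j] at h2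
    rw [j.toInst.fld_deltaT F f x]
    exact (siteNorm_sub_le _ _).trans (add_le_add h1 h2)

include ha hℓ hδT hcT hδB hcB hRT HB in
/-- **(1.11)–(1.12), DERIVATIVE, AT EVERY SITE** (same mechanism on a torus bond of `Ω`; off the bonds the Neumann
derivative vanishes). [cite: Balaban1983RegularityDecay, (1.11)–(1.12) p.573 «for rectangular parallelepipeds … without any restrictions»] -/
theorem dvalDG_band (HT : Ineq111_112 (torusPairFam F d ℓ amin aplus m2plus creg β K j.toInst) α δT cT RT)
    (HF : Ineq19_110 (torusPairFam F d ℓ amin aplus m2plus creg β K (torus j)) α δT cT RT)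
    (μ : Fin (d + 1)) (f : ↥(fineDom ((ℓ + 1) ^ j.k) (boxLabels j.Ms j.o)) × ι → ℝ)
    (x : ↥(fineDom ((ℓ + 1) ^ j.k) (boxLabels j.Ms j.o))) :
    (torusBandFam F d ℓ amin aplus m2plus creg β K K' j).dvalDG μ f x ≤ cNear cT cB δT δB RT *
      Real.exp (-(dHalf δT δB * tsdist1 j.P x f)) *
      Real.exp (-(dHalf δT δB * tcdist j.P x + dHalf δT δB * tbdistS j.P f)) * supN f := by
  show siteNorm (fld (j.toInst.DT F μ *ᵥ j.toInst.deltaT F f) x) ≤ _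
  by_cases hfar : RT ≤ tcdist j.P x
  · have h : siteNorm (fld (j.toInst.DT F μ *ᵥ j.toInst.deltaT F f) x) ≤ cT * Real.exp (-(δT * tsdist1 j.P x f))
        * Real.exp (-(δT * tcdist j.P x + δT * tbdistS j.P f)) * supN f := (HT.2 μ f x (Or.inr hfar)).1
    exact far_bound hδT hcT hδB hcB hRT h (tsdist1_nonneg j.P x f) (tcdist_nonneg j.P x) (tbdistS_nonneg j.P f)
      (supN_nonneg f)
  · have hfar' : tcdist j.P x ≤ RT := (not_le.1 hfar).le
    refine near_bound hδT hcT hδB hcB ?_ (tsdist1_nonneg j.P x f) (supN_nonneg f)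
      (tbdistS_le_tsdist1_add_tcdist (hnk ℓ j.k) j.P j.hP f x) hfar'
    by_cases hxμ : twrap ((ℓ + 1) ^ j.k) j.P (x.1 + e1 μ) ∈ fineDom ((ℓ + 1) ^ j.k) (boxLabels j.Ms j.o)
    · have h1 : siteNorm (fld (j.toInst.DT F μ *ᵥ (j.toInst.GT F *ᵥ f)) x)
          ≤ cB * Real.exp (-(δB * tsdist1 j.P x f)) * supN f := valDG_band j F ha hℓ hδB hcB (K := K) HB μ f x
      have h2 := torus_valDG j F HF μ (j.toInst.extT f) (ιT j x)
      rw [tsdist1_extT j, ← supN_eq_supN_extT j] at h2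
      rw [j.toInst.fld_DT_deltaT F μ f x hxμ]
      exact (siteNorm_sub_le _ _).trans (add_le_add h1 h2)
    · rw [j.toInst.fld_DT_of_not_mem F μ _ x hxμ, siteNorm_zero]
      have := supN_nonneg f
      positivity

set_option maxHeartbeats 400000 in
include ha hℓ hα0 hα1 hδT hcT hδB hcB hRT HB in
/-- **(1.11)–(1.12), HÖLDER MEMBER, AT EVERY PAIR** (dag-p3 g3's bookkeeping verbatim: far from `∂Ω` r01's clause;
within `R₀`, pairs at least one unit apart by the two one-point bounds, closer pairs by the split along every
admissible contour — the `Ω`-term by §3, the `T_η`-term through the inclusion and r01's full-torus (1.9)).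
[cite: Balaban1983RegularityDecay, (1.11)–(1.12) p.573 «for rectangular parallelepipeds … without any restrictions»] -/
theorem dlhs19_band (HT : Ineq111_112 (torusPairFam F d ℓ amin aplus m2plus creg β K j.toInst) α δT cT RT)
    (HF : Ineq19_110 (torusPairFam F d ℓ amin aplus m2plus creg β K (torus j)) α δT cT RT)
    (μ : Fin (d + 1)) (f : ↥(fineDom ((ℓ + 1) ^ j.k) (boxLabels j.Ms j.o)) × ι → ℝ)
    (x x' : ↥(fineDom ((ℓ + 1) ^ j.k) (boxLabels j.Ms j.o))) :
    (torusBandFam F d ℓ amin aplus m2plus creg β K K' j).dlhs19 α μ f x x'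
      ≤ cAll d cT cB δT δB RT * Real.exp (-(dHalf δT δB * min (tsdist1 j.P x f) (tsdist1 j.P x' f))) *
        Real.exp (-(dHalf δT δB * min (tcdist j.P x) (tcdist j.P x') + dHalf δT δB * tbdistS j.P f)) * supN f := by
  show tholderQ j.P F j.toInst.κ j.Ac α μ (j.toInst.DT F μ *ᵥ j.toInst.deltaT F f) x x' ≤ _
  have hd : (0 : ℝ) ≤ d := Nat.cast_nonneg d
  have hN := supN_nonneg f
  have hnpos : (0 : ℝ) < (((ℓ + 1) ^ j.k : ℕ) : ℝ) := by exact_mod_cast hnk ℓ j.k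
  have hm0 : 0 ≤ min (tsdist1 j.P x f) (tsdist1 j.P x' f) := le_min (tsdist1_nonneg j.P x f) (tsdist1_nonneg j.P x' f)
  have hb0 : 0 ≤ min (tcdist j.P x) (tcdist j.P x') := le_min (tcdist_nonneg j.P x) (tcdist_nonneg j.P x')
  have hbS0 := tbdistS_nonneg j.P f
  by_cases hfar : RT ≤ min (tcdist j.P x) (tcdist j.P x')
  · have h : tholderQ j.P F j.toInst.κ j.Ac α μ (j.toInst.DT F μ *ᵥ j.toInst.deltaT F f) x x'
        ≤ cT * Real.exp (-(δT * min (tsdist1 j.P x f) (tsdist1 j.P x' f)))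
          * Real.exp (-(δT * min (tcdist j.P x) (tcdist j.P x') + δT * tbdistS j.P f)) * supN f :=
      HT.1 μ f x x' (Or.inr hfar)
    exact far_bound₂ hδT hcT hδB hcB hRT h hm0 hb0 hbS0 hN
  have hfar' : min (tcdist j.P x) (tcdist j.P x') ≤ RT := (not_le.1 hfar).le
  obtain ⟨hC0, -, -, -, -, -, -⟩ := cAll_bounds (d := d) hδT hcT hδB hcB hRT
  refine tholderQ_le j.P F j.toInst.κ j.Ac (by positivity) fun l hl => ?_
  set V := j.toInst.DT F μ *ᵥ j.toInst.deltaT F f with hV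
  by_cases hnear : tnorm ((ℓ + 1) ^ j.k) j.P (x'.1 - x.1) < (((ℓ + 1) ^ j.k : ℕ) : ℝ)
  · -- pairs closer than one unit: split along the contour
    have hbx := hl.1
    have hbx' := hl.2.1
    have hvx : fld V x = fld (j.toInst.DT F μ *ᵥ (j.toInst.GT F *ᵥ f)) x
        - fld (j.toInst.D₀T F μ *ᵥ (j.toInst.G₀T F *ᵥ j.toInst.extT f)) (ιT j x) :=
      j.toInst.fld_DT_deltaT F μ f x hbx
    have hvx' : fld V x' = fld (j.toInst.DT F μ *ᵥ (j.toInst.GT F *ᵥ f)) x'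
        - fld (j.toInst.D₀T F μ *ᵥ (j.toInst.G₀T F *ᵥ j.toInst.extT f)) (ιT j x') :=
      j.toInst.fld_DT_deltaT F μ f x' hbx'
    set W := transport (fieldLink F j.toInst.κ fun a b : ↥(fineDom ((ℓ + 1) ^ j.k) (boxLabels j.Ms j.o)) =>
        torBond ((ℓ + 1) ^ j.k) j.P j.Ac a.1 b.1) x l with hW
    set v₁ := j.toInst.DT F μ *ᵥ (j.toInst.GT F *ᵥ f) with hv₁
    set v₂ := j.toInst.D₀T F μ *ᵥ (j.toInst.G₀T F *ᵥ j.toInst.extT f) with hv₂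
    have hsplit : W *ᵥ fld V x' - fld V x
        = (W *ᵥ fld v₁ x' - fld v₁ x) - (W *ᵥ fld v₂ (ιT j x') - fld v₂ (ιT j x)) := by
      rw [hvx, hvx', Matrix.mulVec_sub]; abel
    have hw0 : 0 ≤ twt j.P α x x' := Real.rpow_nonneg (div_nonneg (Nat.cast_nonneg _) (tnorm_nonneg _ _ _)) _
    -- the Ω-term
    have hA := holder_term_band j F ha hℓ hα0 hα1 hδB hcB (K' := K') HB (μ := μ) f hl
    -- the T_η-term through the inclusion
    have hadmT := tAdm_ιT j hl
    have hB := (le_tholderQ j.P F (torus j).κ j.Ac v₂ hadmT).trans (torus_lhs19 j F HF μ (j.toInst.extT f) (ιT j x)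
      (ιT j x'))
    rw [twt_ιT j, transport_ιT j F, tsdist1_extT j, tsdist1_extT j, ← supN_eq_supN_extT j] at hB
    have hsum : twt j.P α x x' * siteNorm (W *ᵥ fld V x' - fld V x)
        ≤ 4 * ((d : ℝ) + 1) * (cB * Real.exp (-(δB * min (tsdist1 j.P x f) (tsdist1 j.P x' f))) * supN f)
          + cT * Real.exp (-(δT * min (tsdist1 j.P x f) (tsdist1 j.P x' f))) * supN f := by
      rw [hsplit]
      calc twt j.P α x x' * siteNorm ((W *ᵥ fld v₁ x' - fld v₁ x) - (W *ᵥ fld v₂ (ιT j x') - fld v₂ (ιT j x)))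
          ≤ twt j.P α x x' * (siteNorm (W *ᵥ fld v₁ x' - fld v₁ x)
              + siteNorm (W *ᵥ fld v₂ (ιT j x') - fld v₂ (ιT j x))) :=
            mul_le_mul_of_nonneg_left (siteNorm_sub_le _ _) hw0
        _ ≤ _ := by rw [mul_add]; exact add_le_add hA hB
    -- the factor (1.12): `bS ≤ m + b + 1`
    have hs1 : tsdist1 j.P x f ≤ tsdist1 j.P x' f + 1 := by
      have h := tsdist1_le_tsdist1_add (hnk ℓ j.k) j.P j.hP f x x'
      rw [tnorm_sub_rev (hnk ℓ j.k) j.hP x.1 x'.1] at h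
      have : tnorm ((ℓ + 1) ^ j.k) j.P (x'.1 - x.1) / (((ℓ + 1) ^ j.k : ℕ) : ℝ) ≤ 1 := by
        rw [div_le_one hnpos]; exact hnear.le
      linarith only [h, this]
    have hs2 : tsdist1 j.P x' f ≤ tsdist1 j.P x f + 1 := by
      have h := tsdist1_le_tsdist1_add (hnk ℓ j.k) j.P j.hP f x' x
      have : tnorm ((ℓ + 1) ^ j.k) j.P (x'.1 - x.1) / (((ℓ + 1) ^ j.k : ℕ) : ℝ) ≤ 1 := by
        rw [div_le_one hnpos]; exact hnear.le
      linarith only [h, this]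
    have hbS : tbdistS j.P f ≤ min (tsdist1 j.P x f) (tsdist1 j.P x' f) + min (tcdist j.P x) (tcdist j.P x') + 1 := by
      have e1 := tbdistS_le_tsdist1_add_tcdist (hnk ℓ j.k) j.P j.hP f x
      have e2 := tbdistS_le_tsdist1_add_tcdist (hnk ℓ j.k) j.P j.hP f x'
      have hm1 : tsdist1 j.P x f - 1 ≤ min (tsdist1 j.P x f) (tsdist1 j.P x' f) :=
        le_min (by linarith only) (by linarith only [hs1])
      have hm2 : tsdist1 j.P x' f - 1 ≤ min (tsdist1 j.P x f) (tsdist1 j.P x' f) :=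
        le_min (by linarith only [hs2]) (by linarith only)
      rcases min_choice (tcdist j.P x) (tcdist j.P x') with hmin | hmin <;> rw [hmin]
      · linarith only [e1, hm1]
      · linarith only [e2, hm2]
    exact unitnear_bound hδT hcT hδB hcB hRT hsum hm0 hN hbS hfar'
  · -- pairs at least one unit apart: weight ≤ 1, two one-point bounds
    have hn' : (((ℓ + 1) ^ j.k : ℕ) : ℝ) ≤ tnorm ((ℓ + 1) ^ j.k) j.P (x'.1 - x.1) := not_lt.1 hnear
    have hTpos : 0 < tnorm ((ℓ + 1) ^ j.k) j.P (x'.1 - x.1) := lt_of_lt_of_le hnpos hn'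
    have hw1 : twt j.P α x x' ≤ 1 := by
      unfold twt
      exact Real.rpow_le_one (div_nonneg (Nat.cast_nonneg _) hTpos.le) ((div_le_one hTpos).2 hn') hα0
    have hterm : twt j.P α x x' * siteNorm (transport (fieldLink F j.toInst.κ fun a b :
        ↥(fineDom ((ℓ + 1) ^ j.k) (boxLabels j.Ms j.o)) => torBond ((ℓ + 1) ^ j.k) j.P j.Ac a.1 b.1) x l
          *ᵥ fld V x' - fld V x) ≤ siteNorm (fld V x') + siteNorm (fld V x) := by
      have h := siteNorm_transport_sub_le F j.toInst.κ (fun a b : ↥(fineDom ((ℓ + 1) ^ j.k) (boxLabels j.Ms j.o)) =>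
        torBond ((ℓ + 1) ^ j.k) j.P j.Ac a.1 b.1) x l (fld V x') (fld V x)
      have h0 : 0 ≤ siteNorm (fld V x') + siteNorm (fld V x) := add_nonneg (siteNorm_nonneg _) (siteNorm_nonneg _)
      calc _ ≤ 1 * (siteNorm (fld V x') + siteNorm (fld V x)) :=
            mul_le_mul hw1 h (siteNorm_nonneg _) zero_le_one
        _ = _ := one_mul _
    exact unitfar_bound hδT hcT hδB hcB hRT hterm (dvalDG_band j F ha hℓ hδT hcT hδB hcB hRT (K' := K') HB HT HF μ f x)
      (dvalDG_band j F ha hℓ hδT hcT hδB hcB hRT (K' := K') HB HT HF μ f x') (tcdist_nonneg j.P x)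
      (tcdist_nonneg j.P x') hfar' hN

/-! ### Packaging: the two conjuncts of the typed Theorem for one instance, constants `(dHalf, cAll, R_T)` -/

include ha hℓ hα0 hα1 hδT hcT hδB hcB hRT HB in
/-- **(1.9)–(1.10) FOR THE FAMILY AT ONE INSTANCE**, constants `(δ₀, c₀, R₀) = (dHalf, cAll, R_T)`.
[cite: Balaban1983RegularityDecay, Theorem (1.9)–(1.10) p.573 «without any restrictions on the points x, x′»] -/
theorem fam_ineq19_110 :
    Ineq19_110 (torusBandFam F d ℓ amin aplus m2plus creg β K K' j) α (dHalf δT δB) (cAll d cT cB δT δB RT) RT := by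
  obtain ⟨hC0, hC1, hC3, -, -, -, -⟩ := cAll_bounds (d := d) hδT hcT hδB hcB hRT
  obtain ⟨-, hdr, -⟩ := dHalf_le hδT hδB
  have hδ0 := (dHalf_pos hδT hδB).le
  have hd0 : (0 : ℝ) ≤ d := Nat.cast_nonneg d
  refine ⟨fun μ f x x' _ => ?_, fun μ f x _ => ⟨?_, ?_⟩⟩
  · have h := lhs19_band j F (K := K) ha hℓ hα0 hα1 hδB hcB HB μ f x x'
    exact h.trans (rhs_le hC3 (by positivity) hdr hδ0 le_rfl
      (le_min (tsdist1_nonneg j.P x f) (tsdist1_nonneg j.P x' f)) (supN_nonneg f))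
  · exact (valDG_band j F (K := K) ha hℓ hδB hcB HB μ f x).trans
      (rhs_le hC1 hcB.le hdr hδ0 le_rfl (tsdist1_nonneg j.P x f) (supN_nonneg f))
  · exact (valG_band j F (K := K) ha hℓ hδB hcB HB f x).trans
      (rhs_le hC1 hcB.le hdr hδ0 le_rfl (tsdist1_nonneg j.P x f) (supN_nonneg f))

include ha hℓ hδT hcT hδB hcB hRT HB in
/-- (1.11)–(1.12), derivative member, for the family at one instance, constants `(dHalf, cAll, R_T)` (one declaration per
member: heartbeats). [cite: Balaban1983RegularityDecay, Theorem (1.11)–(1.12) p.573 «without any restrictions on the points x, x′»] -/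
theorem fam_dvalDG (HT : Ineq111_112 (torusPairFam F d ℓ amin aplus m2plus creg β K j.toInst) α δT cT RT)
    (HF : Ineq19_110 (torusPairFam F d ℓ amin aplus m2plus creg β K (torus j)) α δT cT RT)
    (μ : Fin (d + 1)) (f : ↥(fineDom ((ℓ + 1) ^ j.k) (boxLabels j.Ms j.o)) × ι → ℝ)
    (x : ↥(fineDom ((ℓ + 1) ^ j.k) (boxLabels j.Ms j.o))) :
    (torusBandFam F d ℓ amin aplus m2plus creg β K K' j).dvalDG μ f x
      ≤ cAll d cT cB δT δB RT
        * Real.exp (-(dHalf δT δB * (torusBandFam F d ℓ amin aplus m2plus creg β K K' j).sdist1 x f))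
        * Real.exp (-(dHalf δT δB * (torusBandFam F d ℓ amin aplus m2plus creg β K K' j).bdist1 x
            + dHalf δT δB * (torusBandFam F d ℓ amin aplus m2plus creg β K K' j).bdistS f))
        * (torusBandFam F d ℓ amin aplus m2plus creg β K K' j).supNorm f := by
  obtain ⟨-, -, -, hC4, -, -, -⟩ := cAll_bounds (d := d) hδT hcT hδB hcB hRT
  obtain ⟨hN0, -, -⟩ := cNear_bounds hδT hcT hδB hcB hRT
  exact (dvalDG_band j F (K := K) ha hℓ hδT hcT hδB hcB hRT HB HT HF μ f x).trans
    (rhs_le₂ hC4 hN0.le le_rfl (dHalf_pos hδT hδB).le le_rfl (tsdist1_nonneg j.P x f) le_rfl (tcdist_nonneg j.P x)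
      (tbdistS_nonneg j.P f) (supN_nonneg f))

include ha hℓ hδT hcT hδB hcB hRT HB in
/-- (1.11)–(1.12), value member, for the family at one instance. [cite: Balaban1983RegularityDecay, Theorem (1.11)–(1.12) p.573 «without any restrictions on the points x, x′»] -/
theorem fam_dvalG (HT : Ineq111_112 (torusPairFam F d ℓ amin aplus m2plus creg β K j.toInst) α δT cT RT)
    (HF : Ineq19_110 (torusPairFam F d ℓ amin aplus m2plus creg β K (torus j)) α δT cT RT)
    (f : ↥(fineDom ((ℓ + 1) ^ j.k) (boxLabels j.Ms j.o)) × ι → ℝ) (x : ↥(fineDom ((ℓ + 1) ^ j.k) (boxLabels j.Ms j.o))) :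
    (torusBandFam F d ℓ amin aplus m2plus creg β K K' j).dvalG f x
      ≤ cAll d cT cB δT δB RT
        * Real.exp (-(dHalf δT δB * (torusBandFam F d ℓ amin aplus m2plus creg β K K' j).sdist1 x f))
        * Real.exp (-(dHalf δT δB * (torusBandFam F d ℓ amin aplus m2plus creg β K K' j).bdist1 x
            + dHalf δT δB * (torusBandFam F d ℓ amin aplus m2plus creg β K K' j).bdistS f))
        * (torusBandFam F d ℓ amin aplus m2plus creg β K K' j).supNorm f := by
  obtain ⟨-, -, -, hC4, -, -, -⟩ := cAll_bounds (d := d) hδT hcT hδB hcB hRT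
  obtain ⟨hN0, -, -⟩ := cNear_bounds hδT hcT hδB hcB hRT
  exact (dvalG_band j F (K := K) ha hℓ hδT hcT hδB hcB hRT HB HT HF f x).trans
    (rhs_le₂ hC4 hN0.le le_rfl (dHalf_pos hδT hδB).le le_rfl (tsdist1_nonneg j.P x f) le_rfl (tcdist_nonneg j.P x)
      (tbdistS_nonneg j.P f) (supN_nonneg f))

include ha hℓ hα0 hα1 hδT hcT hδB hcB hRT HB in
/-- **(1.11)–(1.12) FOR THE FAMILY AT ONE INSTANCE**, constants `(dHalf, cAll, R_T)`.
[cite: Balaban1983RegularityDecay, Theorem (1.11)–(1.12) p.573 «without any restrictions on the points x, x′»] -/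
theorem fam_ineq111_112 (HT : Ineq111_112 (torusPairFam F d ℓ amin aplus m2plus creg β K j.toInst) α δT cT RT)
    (HF : Ineq19_110 (torusPairFam F d ℓ amin aplus m2plus creg β K (torus j)) α δT cT RT) :
    Ineq111_112 (torusBandFam F d ℓ amin aplus m2plus creg β K K' j) α (dHalf δT δB) (cAll d cT cB δT δB RT) RT :=
  ⟨fun μ f x x' _ => dlhs19_band j F (K := K) ha hℓ hα0 hα1 hδT hcT hδB hcB hRT HB HT HF μ f x x',
    fun μ f x _ => ⟨fam_dvalDG j F ha hℓ hδT hcT hδB hcB hRT HB HT HF μ f x,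
      fam_dvalG j F ha hℓ hδT hcT hδB hcB hRT HB HT HF f x⟩⟩

end Members

/-! ## §5. The Theorem on the family of all parallelepipeds of the torus -/

section Assembly

variable {ℓ : ℕ} {amin aplus m2plus : ℝ}

/-- **THEOREM p. 573, (1.9)–(1.12), «WITHOUT ANY RESTRICTIONS ON THE POINTS x, x′», ON EVERY PARALLELEPIPED OF THE
TORUS** (`Ω` = the unit blocks with labels in ANY box `o + Π[0,Ms) ⊆ Π[0,P)`, wrapping directions allowed, inside
`Ω₀ = T_η`; (1.7)-regular torus field; pv17's typed `η`-uniform form `ThmPrintedNN` with `rect := True`): for every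
`α ∈ [0,1)` ONE `(δ₀, c₀, R₀, e₁)` — `δ₀ = min(δ_T, δ_B)/2`, `c₀ = cAll`, `e₁ = min(e_T, e_B)` from r01's torus Theorem
(`thmPrintedNN_torusPairFam`, modulus `Kmod`) and r04∕p17's box Theorem (`thmPrintedNN_boxPairFamNC`, modulus `KmodNC`,
applied to the SEPARATED COMPONENTS of the periodic lift) — such that every instance with big blocks and `0 < e ≤ e₁`
satisfies (1.9)–(1.12) at ALL points `x, x′ ∈ Ω`. [cite: Balaban1983RegularityDecay, Theorem (1.9)–(1.12) p.573 «For some simple sets Ω, e.g. for rectangular parallelepipeds, the inequalities hold without any restrictions on the points x, x′»; p.572 «operators on subsets of a torus T_η which we identify with a rectangular parallelepiped in ηZ^d with periodic conditions»] -/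
theorem thmPrintedNN_torusBandFam (F : OrthFlow ι) {ℓ₁ : ℝ} (hℓ₁ : 0 ≤ ℓ₁)
    (hLip : ∀ t (v : ι → ℝ), ((F.U t - 1) *ᵥ v) ⬝ᵥ ((F.U t - 1) *ᵥ v) ≤ (ℓ₁ * t) ^ 2 * (v ⬝ᵥ v))
    (d ℓ : ℕ) (hd : 1 ≤ d) (hℓ : 1 ≤ ℓ) (amin aplus m2plus : ℝ) (ha : 0 < amin) (creg β : ℝ) (hcreg : 0 ≤ creg)
    (hβ : 0 < β) :
    ThmPrintedNN (torusBandFam F d ℓ amin aplus m2plus creg β (Kmod F hℓ₁ hLip d ℓ hℓ amin aplus m2plus ha)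
      (KmodNC F hℓ₁ hLip d ℓ hd hℓ amin aplus m2plus ha)) := by
  intro α hα0 hα1
  obtain ⟨δT, cT, RT, eT, hδT, hcT, hRT, heT, HTall⟩ :=
    thmPrintedNN_torusPairFam F hℓ₁ hLip d ℓ hℓ amin aplus m2plus ha creg β hcreg hβ α hα0 hα1
  obtain ⟨δB, cB, RB, eB', hδB, hcB, -, heB', HBall⟩ :=
    thmPrintedNN_boxPairFamNC F hℓ₁ hLip d ℓ hd hℓ amin aplus m2plus ha creg β hcreg hβ α hα0 hα1
  refine ⟨dHalf δT δB, cAll d cT cB δT δB RT, RT, min eT eB', dHalf_pos hδT hδB,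
    (cAll_bounds (d := d) hδT hcT hδB hcB hRT).1, hRT, lt_min heT heB', ?_⟩
  intro j hreg hbig he hle
  have HT := HTall j.toInst (regular_toInst j F hreg) (bigBlocks_toInst j F hbig) he (hle.trans (min_le_left _ _))
  have HF := (HTall (torus j) (regular_torus j F hreg) (bigBlocks_torus j F hbig) he (hle.trans (min_le_left _ _))).1
  have HB : ∀ (R : ℕ) (s : Fin (d + 1) → ℤ), (∀ ν, |s ν| ≤ R) →
      Ineq19_110 (boxPairFamNC F d ℓ amin aplus m2plus creg β (KmodNC F hℓ₁ hLip d ℓ hd hℓ amin aplus m2plus ha)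
        (j.comp R s).boxI) α δB cB RB := by
    intro R s _
    obtain ⟨h1, h2⟩ := comp_boxI_hyps j F (K := Kmod F hℓ₁ hLip d ℓ hℓ amin aplus m2plus ha) hreg hbig R s
    exact (HBall (j.comp R s).boxI h1 h2 he (hle.trans (min_le_right _ _))).1
  exact ⟨fam_ineq19_110 j F ha hℓ hα0 hα1.le hδT hcT hδB hcB hRT HB,
    fam_ineq111_112 j F ha hℓ hα0 hα1.le hδT hcT hδB hcB hRT HB HT.2 HF⟩

/-- **NON-VACUITY**: for every pair of moduli `K, K′ ≥ 1` and every threshold `e₁ > 0` the family has an instance meeting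
`regular ∧ bigBlocks ∧ 0 < e ≤ e₁` — e.g. the zero field on the torus with `3KK′` unit blocks per direction at scale
`k = 1`, `Ω` the parallelepiped of `KK′` blocks per direction at the corner `0` (vacuity standard Q-N00-6).
[cite: Balaban1983RegularityDecay, Theorem p.573 «for e sufficiently small» (non-vacuity bookkeeping)] -/
theorem band_hypotheses_met (F : OrthFlow ι) (d ℓ : ℕ) {amin aplus m2plus : ℝ} (hap : amin ≤ aplus) (hm : 0 ≤ m2plus)
    (creg β : ℝ) (hcreg : 0 ≤ creg) (K K' : ℕ) (hK : 1 ≤ K) (hK' : 1 ≤ K') (e₁ : ℝ) (he₁ : 0 < e₁) :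
    ∃ j : TorusBandInst d ℓ amin aplus m2plus,
      (torusBandFam F d ℓ amin aplus m2plus creg β K K' j).regular ∧
      (torusBandFam F d ℓ amin aplus m2plus creg β K K' j).bigBlocks ∧
      0 < (torusBandFam F d ℓ amin aplus m2plus creg β K K' j).e ∧
      (torusBandFam F d ℓ amin aplus m2plus creg β K K' j).e ≤ e₁ := by
  have hKK : 1 ≤ K * K' := Nat.one_le_iff_ne_zero.2 (Nat.mul_ne_zero (by omega) (by omega))
  have hn1 : 1 ≤ (ℓ + 1) ^ 1 := Nat.one_le_pow _ _ (Nat.succ_pos ℓ)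
  have hΩP : boxLabels (fun _ : Fin (d + 1) => K * K') 0 ⊆ boxDom (fun _ : Fin (d + 1) => 3 * (K * K')) := by
    intro y hy
    rw [mem_boxDom]
    intro i
    obtain ⟨h1, h2⟩ := (mem_boxLabels.1 hy) i
    simp only [Pi.zero_apply, zero_add] at h1 h2
    push_cast at h2 ⊢
    have hKK' : (1 : ℤ) ≤ (K : ℤ) * (K' : ℤ) := by exact_mod_cast hKK
    constructor <;> nlinarith
  let j : TorusBandInst d ℓ amin aplus m2plus :=
    { k := 1, hk := le_rfl, P := fun _ => 3 * (K * K'), hP := fun _ => by omega,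
      h3 := fun ν => by show 3 ≤ (ℓ + 1) ^ 1 * (3 * (K * K')); nlinarith [hn1, hKK],
      Ms := fun _ => K * K', o := 0, hMs := fun _ => hKK, hΩP := hΩP,
      a := amin, m2 := 0, ha1 := le_rfl, ha2 := hap, hm1 := le_rfl, hm2 := hm, Ac := fun _ _ => 0, e := e₁ }
  refine ⟨j, ?_, ?_, he₁, le_rfl⟩
  · intro x _ μ ν
    simp only [j, sub_self, abs_zero]
    positivity
  · have hbox : ∀ M : ℕ, IsBlockUnion K (boxDom fun _ : Fin (d + 1) => K * M) := by
      intro M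
      rw [← fineDom_boxDom hK (fun _ : Fin (d + 1) => M)]
      exact fineDom_isBlockUnion hK _
    have hlab : boxLabels (fun _ : Fin (d + 1) => K * K') 0 = boxDom (fun _ : Fin (d + 1) => K * K') := by
      ext y
      rw [mem_boxLabels, mem_boxDom]
      simp only [Pi.zero_apply, zero_add]
    refine ⟨⟨?_, ?_, fun ν => ?_⟩, fun ν => ?_, fun ν => ?_⟩
    · show IsBlockUnion K (boxDom fun _ : Fin (d + 1) => 3 * (K * K'))
      have : (fun _ : Fin (d + 1) => 3 * (K * K')) = fun _ : Fin (d + 1) => K * (3 * K') := by funext i; ring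
      rw [this]; exact hbox _
    · show IsBlockUnion K (boxLabels (fun _ : Fin (d + 1) => K * K') 0)
      rw [hlab]; exact hbox _
    · exact Dvd.intro _ (by show K * (3 * K') = 3 * (K * K'); ring)
    · exact Dvd.intro_left _ rfl
    · exact Dvd.intro_left _ (by show 3 * K * K' = 3 * (K * K'); ring)

/-- the sign conditions of `torusBandFam`'s functionals (for the joins). [cite: Balaban1983RegularityDecay, Theorem p.573 (typing hygiene of the joint family)] -/
theorem torusBandFam_signs (F : OrthFlow ι) (d ℓ : ℕ) (amin aplus m2plus creg β : ℝ) (K K' : ℕ)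
    (j : TorusBandInst d ℓ amin aplus m2plus) :
    (∀ x f, 0 ≤ (torusBandFam F d ℓ amin aplus m2plus creg β K K' j).sdist1 x f) ∧
    (∀ x x' f, 0 ≤ (torusBandFam F d ℓ amin aplus m2plus creg β K K' j).sdist2 x x' f) ∧
    (∀ x, 0 ≤ (torusBandFam F d ℓ amin aplus m2plus creg β K K' j).bdist1 x) ∧
    (∀ x x', 0 ≤ (torusBandFam F d ℓ amin aplus m2plus creg β K K' j).bdist2 x x') ∧
    (∀ f, 0 ≤ (torusBandFam F d ℓ amin aplus m2plus creg β K K' j).bdistS f) ∧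
    (∀ f, 0 ≤ (torusBandFam F d ℓ amin aplus m2plus creg β K K' j).supNorm f) :=
  ⟨fun x f => tsdist1_nonneg j.P x f, fun x x' f => le_min (tsdist1_nonneg j.P x f) (tsdist1_nonneg j.P x' f),
    fun x => tcdist_nonneg j.P x, fun x x' => le_min (tcdist_nonneg j.P x) (tcdist_nonneg j.P x'),
    fun f => tbdistS_nonneg j.P f, fun f => supN_nonneg f⟩

/-- **THEOREM p. 573 ON THE TORUS `T_η` WITH THE FULL PARALLELEPIPED WAIVER, ONE SET OF CONSTANTS**: `ThmPrintedNN` on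
the join of (T) r01's torus region pairs `Ω ⊂ Ω₀ ⊂ T_η` (`R₀` restriction live) and (TBand) ALL parallelepipeds
`Ω ⊂ Ω₀ = T_η` (`rect := True`, wrapping allowed) — for every `α ∈ [0,1)` one `(δ₀, c₀, R₀, e₁)`.
[cite: Balaban1983RegularityDecay, Theorem (1.9)–(1.12) p.573 incl. «for rectangular parallelepipeds, the inequalities hold without any restrictions on the points x, x′»; p.572 «operators on subsets of a torus T_η»] -/
theorem thmPrintedNN_torusBandJoin (F : OrthFlow ι) {ℓ₁ : ℝ} (hℓ₁ : 0 ≤ ℓ₁)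
    (hLip : ∀ t (v : ι → ℝ), ((F.U t - 1) *ᵥ v) ⬝ᵥ ((F.U t - 1) *ᵥ v) ≤ (ℓ₁ * t) ^ 2 * (v ⬝ᵥ v))
    (d ℓ : ℕ) (hd : 1 ≤ d) (hℓ : 1 ≤ ℓ) (amin aplus m2plus : ℝ) (ha : 0 < amin) (creg β : ℝ) (hcreg : 0 ≤ creg)
    (hβ : 0 < β) :
    ThmPrintedNN (Sum.elim
      (torusPairFam F d ℓ amin aplus m2plus creg β (Kmod F hℓ₁ hLip d ℓ hℓ amin aplus m2plus ha))
      (torusBandFam F d ℓ amin aplus m2plus creg β (Kmod F hℓ₁ hLip d ℓ hℓ amin aplus m2plus ha)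
        (KmodNC F hℓ₁ hLip d ℓ hd hℓ amin aplus m2plus ha))) :=
  thmPrintedNN_sumElim _ _ (fun i => torusPairFam_signs F d ℓ amin aplus m2plus creg β _ i)
    (fun j => torusBandFam_signs F d ℓ amin aplus m2plus creg β _ _ j)
    (thmPrintedNN_torusPairFam F hℓ₁ hLip d ℓ hℓ amin aplus m2plus ha creg β hcreg hβ)
    (thmPrintedNN_torusBandFam F hℓ₁ hLip d ℓ hd hℓ amin aplus m2plus ha creg β hcreg hβ)

/-- **THE SAME IN THE PRINT'S QUANTIFIER ORDER** (p. 573 «δ₀, c₀, R₀ … depending on d, M only, c₀ on α also»): ONE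
`(δ₀, R₀) = (min(δ_T,δ_B)/2, R_T)` BEFORE `α ∈ [0,1)`, from the uniform forms of the two lineage Theorems
(`thmPrintedNNUnif_torusPairFam`, `thmPrintedNNUnif_boxPairFamNC`). [cite: Balaban1983RegularityDecay, Theorem (1.9)–(1.12) p.573 «depending on d, M only, c₀ on α also» + its last sentence] -/
theorem thmPrintedNNUnif_torusBandFam (F : OrthFlow ι) {ℓ₁ : ℝ} (hℓ₁ : 0 ≤ ℓ₁)
    (hLip : ∀ t (v : ι → ℝ), ((F.U t - 1) *ᵥ v) ⬝ᵥ ((F.U t - 1) *ᵥ v) ≤ (ℓ₁ * t) ^ 2 * (v ⬝ᵥ v))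
    (d ℓ : ℕ) (hd : 1 ≤ d) (hℓ : 1 ≤ ℓ) (amin aplus m2plus : ℝ) (ha : 0 < amin) (creg β : ℝ) (hcreg : 0 ≤ creg)
    (hβ : 0 < β) :
    ThmPrintedNNUnif (torusBandFam F d ℓ amin aplus m2plus creg β (Kmod F hℓ₁ hLip d ℓ hℓ amin aplus m2plus ha)
      (KmodNC F hℓ₁ hLip d ℓ hd hℓ amin aplus m2plus ha)) := by
  have HT := thmPrintedNNUnif_torusPairFam F hℓ₁ hLip d ℓ hℓ amin aplus m2plus ha creg β hcreg hβ
  have HB := thmPrintedNNUnif_boxPairFamNC F hℓ₁ hLip d ℓ hd hℓ amin aplus m2plus ha creg β hcreg hβ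
  unfold ThmPrintedNNUnif at HT HB ⊢
  obtain ⟨δT, RT, hδT, hRT, HTα⟩ := HT
  obtain ⟨δB, RB, hδB, -, HBα⟩ := HB
  refine ⟨dHalf δT δB, RT, dHalf_pos hδT hδB, hRT, fun α hα0 hα1 => ?_⟩
  obtain ⟨cT, eT, hcT, heT, HTall⟩ := HTα α hα0 hα1
  obtain ⟨cB, eB', hcB, heB', HBall⟩ := HBα α hα0 hα1
  refine ⟨cAll d cT cB δT δB RT, min eT eB', (cAll_bounds (d := d) hδT hcT hδB hcB hRT).1, lt_min heT heB', ?_⟩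
  intro j hreg hbig he hle
  have HT := HTall j.toInst (regular_toInst j F hreg) (bigBlocks_toInst j F hbig) he (hle.trans (min_le_left _ _))
  have HF := (HTall (torus j) (regular_torus j F hreg) (bigBlocks_torus j F hbig) he (hle.trans (min_le_left _ _))).1
  have HB : ∀ (R : ℕ) (s : Fin (d + 1) → ℤ), (∀ ν, |s ν| ≤ R) →
      Ineq19_110 (boxPairFamNC F d ℓ amin aplus m2plus creg β (KmodNC F hℓ₁ hLip d ℓ hd hℓ amin aplus m2plus ha)
        (j.comp R s).boxI) α δB cB RB := by
    intro R s _
    obtain ⟨h1, h2⟩ := comp_boxI_hyps j F (K := Kmod F hℓ₁ hLip d ℓ hℓ amin aplus m2plus ha) hreg hbig R s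
    exact (HBall (j.comp R s).boxI h1 h2 he (hle.trans (min_le_right _ _))).1
  exact ⟨fam_ineq19_110 j F ha hℓ hα0 hα1.le hδT hcT hδB hcB hRT HB,
    fam_ineq111_112 j F ha hℓ hα0 hα1.le hδT hcT hδB hcB hRT HB HT.2 HF⟩

/-- **THE TORUS JOIN IN THE PRINT'S QUANTIFIER ORDER**: `ThmPrintedNNUnif` on (T) r01's torus pairs ⊕ (TBand) all
parallelepipeds of the torus. [cite: Balaban1983RegularityDecay, Theorem (1.9)–(1.12) p.573 «depending on d, M only, c₀ on α also» + its last sentence] -/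
theorem thmPrintedNNUnif_torusBandJoin (F : OrthFlow ι) {ℓ₁ : ℝ} (hℓ₁ : 0 ≤ ℓ₁)
    (hLip : ∀ t (v : ι → ℝ), ((F.U t - 1) *ᵥ v) ⬝ᵥ ((F.U t - 1) *ᵥ v) ≤ (ℓ₁ * t) ^ 2 * (v ⬝ᵥ v))
    (d ℓ : ℕ) (hd : 1 ≤ d) (hℓ : 1 ≤ ℓ) (amin aplus m2plus : ℝ) (ha : 0 < amin) (creg β : ℝ) (hcreg : 0 ≤ creg)
    (hβ : 0 < β) :
    ThmPrintedNNUnif (Sum.elim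
      (torusPairFam F d ℓ amin aplus m2plus creg β (Kmod F hℓ₁ hLip d ℓ hℓ amin aplus m2plus ha))
      (torusBandFam F d ℓ amin aplus m2plus creg β (Kmod F hℓ₁ hLip d ℓ hℓ amin aplus m2plus ha)
        (KmodNC F hℓ₁ hLip d ℓ hd hℓ amin aplus m2plus ha))) :=
  thmPrintedNNUnif_sumElim _ _ (fun i => torusPairFam_signs F d ℓ amin aplus m2plus creg β _ i)
    (fun j => torusBandFam_signs F d ℓ amin aplus m2plus creg β _ _ j)
    (thmPrintedNNUnif_torusPairFam F hℓ₁ hLip d ℓ hℓ amin aplus m2plus ha creg β hcreg hβ)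
    (thmPrintedNNUnif_torusBandFam F hℓ₁ hLip d ℓ hd hℓ amin aplus m2plus ha creg β hcreg hβ)

end Assembly

end

end Literature.MathematicalPhysics.QuantumFieldTheory.Balaban1983to89.B4ThmTorusBand
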